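import Summits.QuantumFields.YangMills.Theorems.UnitScaleTiltProp8HalvingA1Row165EL
import Summits.QuantumFields.YangMills.Theorems.UnitScaleTiltProp8FlatPortGBandL0
import Summits.QuantumFields.YangMills.Theorems.UnitScaleTiltProp8FlatPortBodyL0
import Summits.QuantumFields.YangMills.Theorems.UnitScaleTiltProp8FlatCubeSequenceAdm
import HarnessLib

/-!
# Route `UnitScaleTilt`, crux K1 child «MinimiserStabilityRegPr» (stmt-QuantumFields-19200), registered stub V2′ `stub_halvingStep`
# (skeletons v8 5b4e846794b80374 / v10 `BirthV10`) — **THE (165)-A₁ ROW OF THE HALVING PACKAGE AT THE CUBE SEQUENCE, P2 SIDE DISCHARGED, EVERY ODD `L ≥ 5`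
# ON TORI WITH `≥ 5L` BIG BLOCKS** (owner socket (σ-3), file 5): `HalvingA1Row165EL.row165_of_slice` fed BY NAME by the P2 lineage's port
# (`FlatPortBodyL0.body_of_adm22`: P2's `H`, `G̃` with their letters, the (161)₁ rows and the (162) row sum; `FlatPortGBandL0.gBand_of_adm22`: the band `G`-row;
# `FlatCubeQContraction.qContrLetter_of_adm22`: the contraction row, `C_Q = L`; `FlatCubeSequenceAdm.adm22_cubeSeqMT3`: the cube sequence is admissible) —
# so that the three (165)-A₁ letters of `HalvingAssembly(Interior).H_of_package(Int)` read from: the F4 solution of (158) w.r.t. the kernel extension of P2's `G̃`,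
# Prop. 4's (98), the (152) sizes, and the slice (153) of the chart field — NOTHING ELSE

Cell `ym3-torus` (HUMAN RULING D-0037, YM ladder rung R3 — continuum SU(2) YM₃ on the torus is a RUNG, not the Clay problem), width seat
`ym-ust-19200-w3` gen 3 (D-0149).  `--supports stmt-QuantumFields-19200 --as helper`; def-free, 0 sorry, standard axioms.

WHAT THIS FILE PROVES: **`row165_L5`** — for every odd `L = ℓ + 1 ≥ 5` there are thresholds `M_h⁰, R₀` and constants `B₀ ≥ 0`, `B_M ≥ 0` (functions of `L`) such that
for every member `F = ⟨L, m⟩`, heights `1 ≤ K − n`, `K − n + 1 ≤ m + K`, big blocks `M = L·M_h`, `M_h = L^{a′} ≥ M_h⁰`, `R ≥ R₀`, torus size `a′ + 3 ≤ m + n`, centre `x₀`,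
radius `ρ ≥ 1`, separation `S ≥ R·M`, and the level weights `w` of `D := cubeSeqMT3 F n K x₀ ρ S M`: THERE IS P2's pinned `G̃` (`IsFlatGt`, with `GtSupLetterG … B₀` — the
`hG` input of F4's `existsUnique_smallSolution158_dom` through `HalvingGtMatrix.matrixGtSup`) such that for EVERY `ℂ`-linear kernel extension `G` of it, every current map `W`
with (98) (`C₄`, `a₃`), every solution `A₁ + G(W(A₁ + 𝔄)) = 0` with (152)-sizes `≤ r < a₃` whose readings lie on the slice `R∂*(φ∘A₁) = 0`, and every
`e ≥ max{B₀, 1 + B_M}·C₄r²`: the three (165)-A₁ conjuncts of the package hold on the layer of the one-point top family at `x₀`.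
HONEST SCOPE: `L = 3` ((P2-L3)) and tori with fewer than `5L` big blocks ((P2-small)) are NOT covered, exactly as for the P2 body; F4∕P3b∕P1 content displayed.  NOT a
claim about the crux, the rung, or the mass gap.

References: T. Bałaban, CMP **102** (1985) 277–309 [Balaban1985Variational] (128) p.297, (131)–(133) p.298, (144) p.300, (152)–(153) p.301, (158) p.302, (161)–(163) p.303,
(165) p.304; CMP **96** (1984) 223–250 [Balaban1984PropagatorsII] (2.1)–(2.2) p.224, (2.16) p.225, Prop. 2.6 (2.136) p.247, Cor. 2.8 (2.150)–(2.151) p.249.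
-/

set_option autoImplicit false

noncomputable section

open scoped BigOperators InnerProductSpace Matrix.Norms.L2Operator

namespace Summit.QuantumFields.YangMills.Theorems.HalvingA1Row165L5

open Literature.MathematicalPhysics.QuantumFieldTheory.Balaban1983to89
open B6GlobalChartV1 (PV)
open B6SectADomainsV1 (Domains)
open B6SectAOperatorsV1 (BondIdx RE dsE)
open B8Ineq132 (BondTouches)
open B8Eq140Level (SideTouches)
open B8Eq143PlaqExpansion (pdiv)
open B8Eq146AExpansion (plaqCovDeriv)
open B8Thm2SetupTorus (pullDom)
open B10Eq27TorusAxialLog (pull transl)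
open T3ContinuumYM3Torus (T3Family)
open FlatCubeOpsText (Adm22 IsLevWeight IsFlatGt GtSupLetterG)
open FlatCubeSequenceAligned (cubeSeqMT3)
open FlatCubeSequenceAdm (adm22_cubeSeqMT3)
open FlatCubeQContraction (qContrLetter_of_adm22)
open FlatPortBodyL0 (body_of_adm22)
open FlatPortGBandL0 (gBand_of_adm22)
open HalvingA1Row165EL (row165_of_slice)

/-- `1 ≤ 3` (named once). [folklore] -/
private theorem hd3 : 1 ≤ 2 + 1 := by norm_num

/-- **THE (165)-A₁ ROW AT THE CUBE SEQUENCE, P2 SIDE DISCHARGED, EVERY ODD `L ≥ 5`** — see the module docstring for the binder list; the conclusion is LITERALLY the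
(165)-A₁ clause of `HalvingAssembly.H_of_package`∕`HalvingAssemblyInterior.H_of_packageInt` (= that of `HalvingA1Row165.row165_of_smallSolution_layer`) with bound `e`.
[cite: Balaban1985Variational, (131)-(133) p.298, (152)-(153) p.301, (158) p.302, (165) p.304; Balaban1984PropagatorsII, (2.1)-(2.2) p.224, Prop. 2.6 (2.136) p.247, Cor. 2.8 (2.150)-(2.151) p.249] -/
theorem row165_L5 (ℓ : ℕ) (hL : Odd (ℓ + 1) ∧ 1 < ℓ + 1) (hℓ : 4 ≤ ℓ) :
    ∃ (Mh₀ R₀ : ℕ) (B₀ BM : ℝ), 0 ≤ B₀ ∧ 0 ≤ BM ∧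
    ∀ (m : ℕ) (hm : 1 ≤ m) (n K : ℕ) (_ : 1 ≤ K - n) (_ : K - n + 1 ≤ m + K) {Mh R a' : ℕ} (_ : Mh = (ℓ + 1) ^ a') (_ : Mh₀ ≤ Mh) (_ : R₀ ≤ R)
      (_ : a' + 3 ≤ m + n) (hM1 : 1 ≤ (ℓ + 1) * Mh) (x₀ : Site (PV 2 ℓ m K hd3 hL) 0) (ρ S : ℕ) (_ : R * ((ℓ + 1) * Mh) ≤ S) (_ : 1 ≤ ρ)
      (w : ℕ → PBond (PV 2 ℓ m K hd3 hL) 0 → ℝ)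
      (_ : IsLevWeight (⟨ℓ + 1, hL, m, hm⟩ : T3Family) n K (cubeSeqMT3 (⟨ℓ + 1, hL, m, hm⟩ : T3Family) n K x₀ ρ S ((ℓ + 1) * Mh) hM1) w),
      ∃ Gt : (PBond (PV 2 ℓ m K hd3 hL) 0 → ℝ) →ₗ[ℝ] (PBond (PV 2 ℓ m K hd3 hL) 0 → ℝ),
        IsFlatGt (⟨ℓ + 1, hL, m, hm⟩ : T3Family) n K (cubeSeqMT3 (⟨ℓ + 1, hL, m, hm⟩ : T3Family) n K x₀ ρ S ((ℓ + 1) * Mh) hM1) Gt ∧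
        GtSupLetterG (⟨ℓ + 1, hL, m, hm⟩ : T3Family) n K w Gt B₀ ∧
        ∀ (G : (PBond (PV 2 ℓ m K hd3 hL) 0 → Matrix (Fin 2) (Fin 2) ℂ) →ₗ[ℂ] (PBond (PV 2 ℓ m K hd3 hL) 0 → Matrix (Fin 2) (Fin 2) ℂ))
          (_ : ∀ (f : PBond (PV 2 ℓ m K hd3 hL) 0 → Matrix (Fin 2) (Fin 2) ℂ) (b : PBond (PV 2 ℓ m K hd3 hL) 0), G f b = ∑ b', Gt (Pi.single b' 1) b • f b')
          (W : (PBond (PV 2 ℓ m K hd3 hL) 0 → Matrix (Fin 2) (Fin 2) ℂ) → (PBond (PV 2 ℓ m K hd3 hL) 0 → Matrix (Fin 2) (Fin 2) ℂ)) {C₄ a₃ r e : ℝ}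
          (_ : ∀ (Y : PBond (PV 2 ℓ m K hd3 hL) 0 → Matrix (Fin 2) (Fin 2) ℂ) (r' : ℝ), r' < a₃ → (∀ b, w 1 b * ‖Y b‖ ≤ r') →
            (∀ (b : PBond (PV 2 ℓ m K hd3 hL) 0) (ν : Fin 3),
              w 2 b * (((ℓ + 1 : ℕ) : ℝ)) ^ (K - n) * ‖Y ⟨b.src.shift ν, b.dir⟩ - Y b‖ ≤ r') →
            ∀ b, w 3 b * ‖W Y b‖ ≤ C₄ * r' ^ 2)
          {A₁ 𝔄 : PBond (PV 2 ℓ m K hd3 hL) 0 → Matrix (Fin 2) (Fin 2) ℂ} (_ : A₁ + G (W (A₁ + 𝔄)) = 0) (_ : r < a₃)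
          (_ : ∀ b, w 1 b * ‖(A₁ + 𝔄) b‖ ≤ r)
          (_ : ∀ (b : PBond (PV 2 ℓ m K hd3 hL) 0) (ν : Fin 3),
            w 2 b * (((ℓ + 1 : ℕ) : ℝ)) ^ (K - n) * ‖(A₁ + 𝔄) ⟨b.src.shift ν, b.dir⟩ - (A₁ + 𝔄) b‖ ≤ r)
          (_ : ∀ φ : Matrix (Fin 2) (Fin 2) ℂ →ₗ[ℝ] ℝ,
            RE (cubeSeqMT3 (⟨ℓ + 1, hL, m, hm⟩ : T3Family) n K x₀ ρ S ((ℓ + 1) * Mh) hM1) ((((ℓ + 1 : ℕ) : ℝ)) ^ (K - n))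
              (dsE ((((ℓ + 1 : ℕ) : ℝ)) ^ (K - n)) (WithLp.toLp 2 (fun b => φ (A₁ b)))) = 0)
          (_ : B₀ * (C₄ * r ^ 2) ≤ e) (_ : (1 + BM) * (C₄ * r ^ 2) ≤ e),
          (∀ (z : B7Prop1Explicit.Site (PV 2 ℓ m K hd3 hL).d) (τ : Fin (PV 2 ℓ m K hd3 hL).d),
            SideTouches (pullDom (fun j => if K - n ≤ j then ({x₀} : Set (Site (PV 2 ℓ m K hd3 hL) 0)) else (∅ : Set (Site (PV 2 ℓ m K hd3 hL) 0))) (K - n)) z τ →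
            ‖A₁ ⟨transl 0 z, τ⟩‖ ≤ e) ∧
          (∀ (z : B7Prop1Explicit.Site (PV 2 ℓ m K hd3 hL).d) (κ τ : Fin (PV 2 ℓ m K hd3 hL).d),
            SideTouches (pullDom (fun j => if K - n ≤ j then ({x₀} : Set (Site (PV 2 ℓ m K hd3 hL) 0)) else (∅ : Set (Site (PV 2 ℓ m K hd3 hL) 0))) (K - n)) z τ →
            ‖(((((ℓ + 1 : ℕ) : ℝ))⁻¹) ^ (K - n))⁻¹ • (A₁ ⟨(transl 0 z).shift κ, τ⟩ - A₁ ⟨transl 0 z, τ⟩)‖ ≤ e) ∧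
          (∀ (z : B7Prop1Explicit.Site (PV 2 ℓ m K hd3 hL).d) (μ : Fin (PV 2 ℓ m K hd3 hL).d),
            BondTouches (pullDom (fun j => if K - n ≤ j then ({x₀} : Set (Site (PV 2 ℓ m K hd3 hL) 0)) else (∅ : Set (Site (PV 2 ℓ m K hd3 hL) 0))) (K - n)) z μ →
            ‖pdiv (((((ℓ + 1 : ℕ) : ℝ))⁻¹) ^ (K - n)) (1 : B7Prop1Explicit.Site (PV 2 ℓ m K hd3 hL).d → Fin (PV 2 ℓ m K hd3 hL).d → (Matrix (Fin 2) (Fin 2) ℂ)ˣ)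
                (plaqCovDeriv (((((ℓ + 1 : ℕ) : ℝ))⁻¹) ^ (K - n))
                  (1 : B7Prop1Explicit.Site (PV 2 ℓ m K hd3 hL).d → Fin (PV 2 ℓ m K hd3 hL).d → (Matrix (Fin 2) (Fin 2) ℂ)ˣ) (pull A₁ 0)) μ z‖ ≤ e) := by
  obtain ⟨Mh₀, R₀, B₀, δ₀, B₃, hδ₀, hB₃, hbody⟩ := body_of_adm22 ℓ hL hℓ
  obtain ⟨Mh₀', R₀', CG, hCG, hband⟩ := gBand_of_adm22 ℓ hL hℓ
  have hL0 : (0 : ℝ) ≤ (((ℓ + 1 : ℕ) : ℝ)) := by positivity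
  -- `B₀ ≥ 0` is forced at any admissible instance; export `max B₀ 0` and identify it inside
  refine ⟨max Mh₀ Mh₀', max (max R₀ R₀') 2, max B₀ 0, (max B₀ 0 * B₃ + 1) * (((ℓ + 1 : ℕ) : ℝ)) * CG, le_max_right _ _, by positivity, ?_⟩
  intro m hm n K hk1 hk' Mh R a' hMha hMh hR hsize hM1 x₀ ρ S hRS hρ1 w hw
  have hnK : n < K := by omega
  set D := cubeSeqMT3 (⟨ℓ + 1, hL, m, hm⟩ : T3Family) n K x₀ ρ S ((ℓ + 1) * Mh) hM1 with hD
  have hAdm : Adm22 D R ((ℓ + 1) * Mh) := adm22_cubeSeqMT3 (⟨ℓ + 1, hL, m, hm⟩ : T3Family) n K x₀ ρ hM1 hRS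
  have hMh₀ : Mh₀ ≤ Mh := le_trans (le_max_left _ _) hMh
  have hMh₀' : Mh₀' ≤ Mh := le_trans (le_max_right _ _) hMh
  have hR₀ : R₀ ≤ R := le_trans (le_trans (le_max_left _ _) (le_max_left _ _)) hR
  have hR₀' : R₀' ≤ R := le_trans (le_trans (le_max_right _ _) (le_max_left _ _)) hR
  have hR2 : 2 ≤ R := le_trans (le_max_right _ _) hR
  have hRM : 2 * (⟨ℓ + 1, hL, m, hm⟩ : T3Family).L ≤ R * ((ℓ + 1) * Mh) := by
    show 2 * (ℓ + 1) ≤ R * ((ℓ + 1) * Mh)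
    calc 2 * (ℓ + 1) ≤ R * (ℓ + 1) := Nat.mul_le_mul_right _ hR2
      _ ≤ R * ((ℓ + 1) * Mh) := Nat.mul_le_mul_left _ (Nat.le_mul_of_pos_right _ (by rw [hMha]; positivity))
  -- P2's objects and letters at `D`
  obtain ⟨H, Gt, hFH, hFG, hHs, hGs, -, dBI, hdom, h162, hHd⟩ := hbody m hm n K hk1 hk' hMha hMh₀ hR₀ hsize D rfl hAdm w hw
  have hB₀ : 0 ≤ B₀ := by
    have h := (hHs 0 1 zero_le_one (fun c => by simp)).1 ⟨x₀, ⟨0, by norm_num⟩⟩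
    simpa using h
  have hmax : max B₀ 0 = B₀ := max_eq_left hB₀
  -- the band `G`-row and the contraction row at `D`
  obtain ⟨w', hw', Ga, hGW, hGas, hwband⟩ := hband m hm n K hk1 hk' hMha hMh₀' hR₀' hsize D rfl hAdm w hw
  have hQ := qContrLetter_of_adm22 (⟨ℓ + 1, hL, m, hm⟩ : T3Family) n K D rfl hAdm hRM w hw
  refine ⟨Gt, hFG, by rw [hmax]; exact hGs, ?_⟩
  intro G hGker W C₄ a₃ r e hWq A₁ 𝔄 hsol hr h1 h2 hslice he₁ he₂
  rw [hmax] at he₁ he₂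
  exact row165_of_slice (F := (⟨ℓ + 1, hL, m, hm⟩ : T3Family)) hnK x₀ ρ S ((ℓ + 1) * Mh) hM1 hρ1 hw hFH hHd h162 hdom hδ₀.le hB₀ hB₃.le
    hFG hGs hw' hGW hGas hwband hQ hCG hL0
    G hGker W hWq hsol hr h1 h2 hslice he₁ he₂

end Summit.QuantumFields.YangMills.Theorems.HalvingA1Row165L5

end
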